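import Summits.AtomisticToContinuum.FouriersLaw.Theses.PhononMeanFreePath
import Summits.AtomisticToContinuum.FouriersLaw.Theorems.BoundaryKubo.Negative.LoadBearing
import Summits.AtomisticToContinuum.FouriersLaw.Theorems.PhononMeanFreePathBoundaryKuboLimitExchangeAux1
import Summits.AtomisticToContinuum.FouriersLaw.Theorems.IncoherentChannel.Negative.GibbsStein

/-!
# Limit exchange: the linear response of the end kinetic temperature
(stub `stub_limitExchange` of line `gibbs-ttcf`, crux stmt-AtomisticToContinuum-11812 `PhononMeanFreePath.BoundaryKubo`)

For the pinned chain `pinnedChain ω₂ lam β γ` (all `> 0`), `N + 1` sites, `T > 0`, `μ₀ = gibbsMeasure (N+1) T`,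
`K^δ_s = transitionKernel (N+1) (T+δ/2) (T-δ/2) s`: ASSUMING (H1) a Harris bound uniform in `|δ| ≤ δ₀` with weak steady
limits `ν_δ`, (H2) the finite-time Gibbs TTCF identity and (H3) continuity of the kernels in the bath temperatures,
under weak-NESS uniqueness and along every steady family `μ`:
`(μ_{(N+1),T+δ/2,T-δ/2}(p_N²) - T)/δ → (γ/2T²)(∫₀^∞ Y - ∫₀^∞ X)`, `Y = kuboIntegrand`, `X(t) = Cov_{μ₀}(p_N², K_t p_N²)`.

* `steady_response_of_identity` — `S → ∞` in (H2) at fixed `δ` by the Harris bound (recentring with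
  `μ₀(p_0²) = μ₀(p_N²) = T`): `ν_δ(p_N²) - T = δ(γ/2T²) Ψ(δ)`, `Ψ(δ) = ∫₀^∞ μ₀((p_0² - p_N²) K^δ_s p_N²) ds`, with
  `|μ₀((p_0² - p_N²) K^δ_s p_N²)| ≤ M e^{-cs}` uniformly in `δ`;
* `gibbs_cov_integrableOn`, `integral_kubo_sub_auto` — `X, Y ∈ L¹(0,∞)` and `∫ Y - ∫ X = Ψ(0)` from the `δ = 0`
  Harris bound (limit = `μ₀`);
* `stub_limitExchange` — identification `μ_δ = ν_δ` (uniqueness; `ν_0 = μ₀`, `steadyFamily_apply_self`),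
  `Ψ(δ) → Ψ(0)` by dominated convergence in `s` with `tendsto_corr_delta` (helper 1) inside.
-/

noncomputable section

open scoped NNReal ENNReal Topology
open MeasureTheory Filter Set

namespace Summit.AtomisticToContinuum.FouriersLaw.Theorems.BoundaryKubo.GibbsTtcf

open Literature.MathematicalPhysics.KineticTheory.HeatConduction
open Literature.MathematicalPhysics.KineticTheory Literature.Probability.Process OscillatorChain
open ProbabilityTheory
open Summit.AtomisticToContinuum.FouriersLaw.Theorems.SubdiffusiveBondHeat
open Summit.AtomisticToContinuum.FouriersLaw.Theorems.IncoherentChannel.Negative.GibbsStein (gibbs_sq_momentum)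
open Summit.AtomisticToContinuum.FouriersLaw.Theorems.IncoherentChannel.Negative.KernelMoments
  (sq_momentum_le_two_mul_hamiltonian)
open Summit.AtomisticToContinuum.FouriersLaw.Theorems.BoundaryKubo.Negative.LoadBearing
  (kuboIntegrand kuboValue LimitClause UniqueSteady SteadyFamily boundaryKubo_iff steadyFamily_apply_self)

/-! ### `S → ∞` in the Gibbs TTCF identity; decay of Gibbs covariances -/

section OnePair

variable {ω₂ lam β γ : ℝ} (hω : 0 < ω₂) (hl : 0 ≤ lam) (hβ : 0 ≤ β) (hγ : 0 ≤ γ) {N : ℕ}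
  {a b : ℝ} {ν : Measure (PhaseSpace (N + 1))} {θ C c : ℝ} (hθ : 0 < θ) (hc : 0 < c)
  (hH : ∀ (z : PhaseSpace (N + 1)) (t : ℝ≥0) (f : PhaseSpace (N + 1) → ℝ), Continuous f →
    (∀ y, |f y| ≤ Real.exp (θ * (pinnedChain ω₂ lam β γ).hamiltonian (N + 1) y)) →
    |(∫ y, f y ∂((pinnedChain ω₂ lam β γ).transitionKernel (N + 1) a b t z)) - ∫ y, f y ∂ν| ≤
      C * Real.exp (θ * (pinnedChain ω₂ lam β γ).hamiltonian (N + 1) z) * Real.exp (-c * t))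
  {T : ℝ} (hT : 0 < T) (hθT : θ * T < 1)
include hω hl hβ hγ hθ hc hH hT hθT

/-- **`S → ∞` in the finite-time identity.** Given the Harris bound at `(a, b)` with limit `ν`, the Gibbs
measure `μ₀` at `T` (`θT < 1`) and an identity `μ₀(K_S p_N²) - μ₀(p_N²) = κ ∫₀^S Φ` for all `S ≥ 0` with
`Φ(s) = μ₀((p_0² - p_N²) · K_s p_N²)`: `Φ` is integrable on `(0, ∞)`, `|Φ(s)| ≤ M_Φ e^{-cs}` with a constant
`M_Φ` depending only on `(θ, C, T)` (recentring by `μ₀(p_0²) = μ₀(p_N²) = T`, `corr_decay`), and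
`ν(p_N²) - T = κ ∫_{(0,∞)} Φ` (the left side tends to `ν(p_N²) - μ₀(p_N²)` by `corr_decay` with `g = 1`).
[folklore] -/
theorem steady_response_of_identity {κ : ℝ}
    (hid : ∀ S : ℝ, 0 ≤ S →
      (∫ z, (∫ y, (y.2 (Fin.last N)) ^ 2
          ∂((pinnedChain ω₂ lam β γ).transitionKernel (N + 1) a b S.toNNReal z))
          ∂((pinnedChain ω₂ lam β γ).gibbsMeasure (N + 1) T)) -
        (∫ z, (z.2 (Fin.last N)) ^ 2 ∂((pinnedChain ω₂ lam β γ).gibbsMeasure (N + 1) T)) =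
      κ * ∫ s in (0 : ℝ)..S, ∫ z, ((z.2 0) ^ 2 - (z.2 (Fin.last N)) ^ 2) *
          (∫ y, (y.2 (Fin.last N)) ^ 2
            ∂((pinnedChain ω₂ lam β γ).transitionKernel (N + 1) a b s.toNNReal z))
          ∂((pinnedChain ω₂ lam β γ).gibbsMeasure (N + 1) T)) :
    IntegrableOn (fun s : ℝ => ∫ z, ((z.2 0) ^ 2 - (z.2 (Fin.last N)) ^ 2) *
        (∫ y, (y.2 (Fin.last N)) ^ 2 ∂((pinnedChain ω₂ lam β γ).transitionKernel (N + 1) a b s.toNNReal z))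
        ∂((pinnedChain ω₂ lam β γ).gibbsMeasure (N + 1) T)) (Ioi 0) ∧
    (∀ s : ℝ, 0 ≤ s → |∫ z, ((z.2 0) ^ 2 - (z.2 (Fin.last N)) ^ 2) *
        (∫ y, (y.2 (Fin.last N)) ^ 2 ∂((pinnedChain ω₂ lam β γ).transitionKernel (N + 1) a b s.toNNReal z))
        ∂((pinnedChain ω₂ lam β γ).gibbsMeasure (N + 1) T)| ≤
      2 / θ * C * (4 / ((1 / T - θ) / 2)) *
        (∫ z, Real.exp ((θ + (1 / T - θ) / 2) * (pinnedChain ω₂ lam β γ).hamiltonian (N + 1) z)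
          ∂((pinnedChain ω₂ lam β γ).gibbsMeasure (N + 1) T)) * Real.exp (-c * s)) ∧
    (∫ y, (y.2 (Fin.last N)) ^ 2 ∂ν) - T =
      κ * ∫ s in Ioi (0 : ℝ), ∫ z, ((z.2 0) ^ 2 - (z.2 (Fin.last N)) ^ 2) *
        (∫ y, (y.2 (Fin.last N)) ^ 2 ∂((pinnedChain ω₂ lam β γ).transitionKernel (N + 1) a b s.toNNReal z))
        ∂((pinnedChain ω₂ lam β γ).gibbsMeasure (N + 1) T) := by
  set P := pinnedChain ω₂ lam β γ with hPdef
  set μ₀ := P.gibbsMeasure (N + 1) T with hμ₀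
  set ϑ := (1 / T - θ) / 2 with hϑ
  set Φ : ℝ → ℝ := fun s => ∫ z, ((z.2 0) ^ 2 - (z.2 (Fin.last N)) ^ 2) *
    (∫ y, (y.2 (Fin.last N)) ^ 2 ∂(P.transitionKernel (N + 1) a b s.toNNReal z)) ∂μ₀ with hΦ
  set m : ℝ := ∫ y, (y.2 (Fin.last N)) ^ 2 ∂ν with hm
  haveI : IsProbabilityMeasure μ₀ := pinnedChain_isProbabilityMeasure_gibbsMeasure hω hl hβ γ (N + 1) hT
  have hP : P.IsConfining := pinnedChain_isConfining hω hl hβ hγ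
  have hθT' : θ < 1 / T := by rwa [lt_div_iff₀ hT]
  have hϑ0 : 0 < ϑ := by rw [hϑ]; linarith
  have hθϑ : θ + ϑ < 1 / T := by rw [hϑ]; linarith
  -- Gibbs moments
  have hpT : ∀ i : Fin (N + 1), ∫ z, z.2 i ^ 2 ∂μ₀ = T := fun i => gibbs_sq_momentum hω hl hβ hT i
  have hpi : ∀ i : Fin (N + 1), Integrable (fun z : PhaseSpace (N + 1) => z.2 i ^ 2) μ₀ := fun i =>
    integrable_of_abs_le_exp (pinnedChain_integrable_exp_mul_hamiltonian_gibbsMeasure hω hl hβ γ (N + 1) hT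
      (by linarith : ϑ < 1 / T)) (by fun_prop) (fun z => abs_sq_momentum_le_exp hP hϑ0 (N + 1) z i)
  have hW0 : ∫ z, ((z.2 0) ^ 2 - (z.2 (Fin.last N)) ^ 2) ∂μ₀ = 0 := by
    rw [integral_sub (hpi 0) (hpi _), hpT, hpT, sub_self]
  -- the weights `W = p_0² - p_N²` and `1`
  have hWc : Continuous fun z : PhaseSpace (N + 1) => (z.2 0) ^ 2 - (z.2 (Fin.last N)) ^ 2 := by fun_prop
  have hWb : ∀ z : PhaseSpace (N + 1), |(z.2 0) ^ 2 - (z.2 (Fin.last N)) ^ 2| ≤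
      4 / ϑ * Real.exp (ϑ * P.hamiltonian (N + 1) z) := fun z => abs_sq_sub_sq_le_exp hP hϑ0 (N + 1) z _ _
  have h1b : ∀ z : PhaseSpace (N + 1), |(1 : ℝ)| ≤ 1 * Real.exp (ϑ * P.hamiltonian (N + 1) z) := fun z => by
    rw [abs_one, one_mul]
    exact Real.one_le_exp (mul_nonneg hϑ0.le (hP.hamiltonian_nonneg (N + 1) z))
  -- decay of `Φ`
  have hΦb : ∀ s : ℝ, 0 ≤ s → |Φ s| ≤ 2 / θ * C * (4 / ϑ) *
      (∫ z, Real.exp ((θ + ϑ) * P.hamiltonian (N + 1) z) ∂μ₀) * Real.exp (-c * s) := by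
    intro s hs
    have h := (corr_decay hω hl hβ hγ hθ hH hT hθϑ hWc hWb (Fin.last N) s.toNNReal).2
    rwa [hW0, zero_mul, sub_zero, Real.coe_toNNReal _ hs] at h
  have hΦm : Measurable Φ := measurable_corr_time hω hl hβ hγ (N + 1) a b μ₀ hWc (by fun_prop)
  have hΦi : IntegrableOn Φ (Ioi 0) := integrableOn_Ioi_of_abs_le_exp hc hΦm fun s hs => hΦb s hs.le
  refine ⟨hΦi, hΦb, ?_⟩
  -- the left-hand side tends to `m - T`
  have hL : Tendsto (fun S : ℝ => (∫ z, (∫ y, (y.2 (Fin.last N)) ^ 2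
      ∂(P.transitionKernel (N + 1) a b S.toNNReal z)) ∂μ₀) - ∫ z, (z.2 (Fin.last N)) ^ 2 ∂μ₀)
      atTop (𝓝 (m - T)) := by
    refine tendsto_of_abs_sub_le_exp hc
      (M := 2 / θ * C * 1 * ∫ z, Real.exp ((θ + ϑ) * P.hamiltonian (N + 1) z) ∂μ₀) fun S hS => ?_
    have h := (corr_decay hω hl hβ hγ hθ hH hT hθϑ continuous_const h1b (Fin.last N) S.toNNReal).2
    simp only [one_mul, integral_const, probReal_univ, smul_eq_mul] at h
    rw [Real.coe_toNNReal _ hS] at h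
    rw [hpT]
    calc _ = |(∫ z, ∫ y, y.2 (Fin.last N) ^ 2 ∂(P.transitionKernel (N + 1) a b S.toNNReal z) ∂μ₀) - m| := by
          ring_nf
      _ ≤ _ := h
  exact eq_integral_Ioi_of_interval_identity hL hΦi hid

/-- **Exponential decay and integrability of a Gibbs covariance** `t ↦ μ₀(p_i² · K_t p_N²) - μ₀(p_i²) μ₀(K_t p_N²)`
when the Harris limit at `(a, b)` IS the Gibbs measure (`ν = μ₀`): integrability of `z ↦ p_i² K_t p_N²` and
of `z ↦ K_t p_N²` under `μ₀` for every `t`, and integrability of the covariance on `(0, ∞)` (bound `M e^{-ct}` by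
`corr_decay` with `g = p_i²` and `g = 1`, measurability in `t` by `measurable_corr_time`). [folklore] -/
theorem gibbs_cov_integrableOn (hν : ν = (pinnedChain ω₂ lam β γ).gibbsMeasure (N + 1) T) (i : Fin (N + 1)) :
    (∀ t : ℝ≥0, Integrable (fun z : PhaseSpace (N + 1) => z.2 i ^ 2 * ∫ y, (y.2 (Fin.last N)) ^ 2
        ∂((pinnedChain ω₂ lam β γ).transitionKernel (N + 1) a b t z))
        ((pinnedChain ω₂ lam β γ).gibbsMeasure (N + 1) T) ∧
      Integrable (fun z : PhaseSpace (N + 1) => ∫ y, (y.2 (Fin.last N)) ^ 2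
        ∂((pinnedChain ω₂ lam β γ).transitionKernel (N + 1) a b t z))
        ((pinnedChain ω₂ lam β γ).gibbsMeasure (N + 1) T)) ∧
    IntegrableOn (fun t : ℝ => (∫ z, (z.2 i) ^ 2 * (∫ y, (y.2 (Fin.last N)) ^ 2
        ∂((pinnedChain ω₂ lam β γ).transitionKernel (N + 1) a b t.toNNReal z))
        ∂((pinnedChain ω₂ lam β γ).gibbsMeasure (N + 1) T)) -
      (∫ z, (z.2 i) ^ 2 ∂((pinnedChain ω₂ lam β γ).gibbsMeasure (N + 1) T)) *
        (∫ z, (∫ y, (y.2 (Fin.last N)) ^ 2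
          ∂((pinnedChain ω₂ lam β γ).transitionKernel (N + 1) a b t.toNNReal z))
          ∂((pinnedChain ω₂ lam β γ).gibbsMeasure (N + 1) T))) (Ioi 0) := by
  set P := pinnedChain ω₂ lam β γ with hPdef
  set μ₀ := P.gibbsMeasure (N + 1) T with hμ₀
  set ϑ := (1 / T - θ) / 2 with hϑ
  haveI : IsProbabilityMeasure μ₀ := pinnedChain_isProbabilityMeasure_gibbsMeasure hω hl hβ γ (N + 1) hT
  have hP : P.IsConfining := pinnedChain_isConfining hω hl hβ hγ
  have hθT' : θ < 1 / T := by rwa [lt_div_iff₀ hT]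
  have hϑ0 : 0 < ϑ := by rw [hϑ]; linarith
  have hθϑ : θ + ϑ < 1 / T := by rw [hϑ]; linarith
  have hpT : ∀ j : Fin (N + 1), ∫ z, z.2 j ^ 2 ∂μ₀ = T := fun j => gibbs_sq_momentum hω hl hβ hT j
  have hm : ∫ y, (y.2 (Fin.last N)) ^ 2 ∂ν = T := by rw [hν]; exact hpT _
  have hpc : Continuous fun z : PhaseSpace (N + 1) => z.2 i ^ 2 := by fun_prop
  have hAc : Continuous fun y : PhaseSpace (N + 1) => y.2 (Fin.last N) ^ 2 := by fun_prop
  have hpb : ∀ z : PhaseSpace (N + 1), |z.2 i ^ 2| ≤ 2 / ϑ * Real.exp (ϑ * P.hamiltonian (N + 1) z) :=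
    fun z => abs_sq_momentum_le_exp hP hϑ0 (N + 1) z i
  have h1b : ∀ z : PhaseSpace (N + 1), |(1 : ℝ)| ≤ 1 * Real.exp (ϑ * P.hamiltonian (N + 1) z) := fun z => by
    rw [abs_one, one_mul]
    exact Real.one_le_exp (mul_nonneg hϑ0.le (hP.hamiltonian_nonneg (N + 1) z))
  set I := ∫ z, Real.exp ((θ + ϑ) * P.hamiltonian (N + 1) z) ∂μ₀ with hI
  have hg := fun t : ℝ≥0 => corr_decay hω hl hβ hγ hθ hH hT hθϑ hpc hpb (Fin.last N) t
  have h1 := fun t : ℝ≥0 => corr_decay hω hl hβ hγ hθ hH hT hθϑ continuous_const h1b (Fin.last N) t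
  simp only [one_mul, integral_const, probReal_univ, smul_eq_mul] at h1
  refine ⟨fun t => ⟨(hg t).1, (h1 t).1⟩, ?_⟩
  have h1m : Measurable fun t : ℝ => ∫ z, (∫ y, (y.2 (Fin.last N)) ^ 2
      ∂(P.transitionKernel (N + 1) a b t.toNNReal z)) ∂μ₀ := by
    simpa only [one_mul] using
      measurable_corr_time hω hl hβ hγ (N + 1) a b μ₀ (continuous_const (y := (1 : ℝ))) hAc
  refine integrableOn_Ioi_of_abs_le_exp hc (M := 2 / θ * C * (2 / ϑ) * I + T * (2 / θ * C * 1 * I))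
    ((measurable_corr_time hω hl hβ hγ (N + 1) a b μ₀ hpc hAc).sub (h1m.const_mul _)) fun t ht => ?_
  have hgt := (hg t.toNNReal).2
  have h1t := (h1 t.toNNReal).2
  rw [Real.coe_toNNReal _ ht.le, hm] at hgt h1t
  rw [hpT] at hgt ⊢
  set X := ∫ z, z.2 i ^ 2 * ∫ y, y.2 (Fin.last N) ^ 2 ∂(P.transitionKernel (N + 1) a b t.toNNReal z) ∂μ₀
  set Y := ∫ z, ∫ y, y.2 (Fin.last N) ^ 2 ∂(P.transitionKernel (N + 1) a b t.toNNReal z) ∂μ₀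
  calc |X - T * Y| = |(X - T * T) - T * (Y - T)| := by ring_nf
    _ ≤ |X - T * T| + |T * (Y - T)| := abs_sub _ _
    _ ≤ 2 / θ * C * (2 / ϑ) * I * Real.exp (-c * t) + T * (2 / θ * C * 1 * I * Real.exp (-c * t)) := by
        refine add_le_add hgt ?_
        rw [abs_mul, abs_of_pos hT]
        exact mul_le_mul_of_nonneg_left h1t hT.le
    _ = _ := by ring

end OnePair

/-! ### The value at `δ = 0`: `∫ Φ₀ = ∫ Y - ∫ X` -/

/-- **The value of the limit.** If the Harris limit at equal temperatures `(T, T)` is the Gibbs measure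
`μ₀`, then `Y = kuboIntegrand` and the autocorrelation integrand `X` are integrable on `(0, ∞)` and
`∫ Y - ∫ X = ∫_{(0,∞)} μ₀((p_0² - p_N²) · K_s p_N²) ds` (the product terms cancel because
`μ₀(p_0²) = μ₀(p_N²) = T`). [folklore] -/
theorem integral_kubo_sub_auto {ω₂ lam β γ : ℝ} (hω : 0 < ω₂) (hl : 0 ≤ lam) (hβ : 0 ≤ β) (hγ : 0 ≤ γ)
    {N : ℕ} {T θ C c : ℝ} (hT : 0 < T) (hθ : 0 < θ) (hθT : θ * T < 1) (hc : 0 < c)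
    (hH : ∀ (z : PhaseSpace (N + 1)) (t : ℝ≥0) (f : PhaseSpace (N + 1) → ℝ), Continuous f →
      (∀ y, |f y| ≤ Real.exp (θ * (pinnedChain ω₂ lam β γ).hamiltonian (N + 1) y)) →
      |(∫ y, f y ∂((pinnedChain ω₂ lam β γ).transitionKernel (N + 1) T T t z)) -
          ∫ y, f y ∂((pinnedChain ω₂ lam β γ).gibbsMeasure (N + 1) T)| ≤
        C * Real.exp (θ * (pinnedChain ω₂ lam β γ).hamiltonian (N + 1) z) * Real.exp (-c * t)) :
    (∫ t in Ioi (0 : ℝ), kuboIntegrand ω₂ lam β γ T N t) -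
      ∫ t in Ioi (0 : ℝ), ((∫ z, (z.2 (Fin.last N)) ^ 2 * (∫ y, (y.2 (Fin.last N)) ^ 2
              ∂((pinnedChain ω₂ lam β γ).transitionKernel (N + 1) T T t.toNNReal z))
              ∂((pinnedChain ω₂ lam β γ).gibbsMeasure (N + 1) T)) -
            (∫ z, (z.2 (Fin.last N)) ^ 2 ∂((pinnedChain ω₂ lam β γ).gibbsMeasure (N + 1) T)) *
              (∫ z, (∫ y, (y.2 (Fin.last N)) ^ 2
                ∂((pinnedChain ω₂ lam β γ).transitionKernel (N + 1) T T t.toNNReal z))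
                ∂((pinnedChain ω₂ lam β γ).gibbsMeasure (N + 1) T))) =
    ∫ s in Ioi (0 : ℝ), ∫ z, ((z.2 0) ^ 2 - (z.2 (Fin.last N)) ^ 2) *
        (∫ y, (y.2 (Fin.last N)) ^ 2 ∂((pinnedChain ω₂ lam β γ).transitionKernel (N + 1) T T s.toNNReal z))
        ∂((pinnedChain ω₂ lam β γ).gibbsMeasure (N + 1) T) := by
  set P := pinnedChain ω₂ lam β γ with hPdef
  set μ₀ := P.gibbsMeasure (N + 1) T with hμ₀
  have hpT : ∀ j : Fin (N + 1), ∫ z, z.2 j ^ 2 ∂μ₀ = T := fun j => gibbs_sq_momentum hω hl hβ hT j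
  obtain ⟨hY1, hYi⟩ := gibbs_cov_integrableOn hω hl hβ hγ hθ hc hH hT hθT rfl 0
  obtain ⟨hX1, hXi⟩ := gibbs_cov_integrableOn hω hl hβ hγ hθ hc hH hT hθT rfl (Fin.last N)
  unfold kuboIntegrand
  rw [← integral_sub hYi hXi]
  refine integral_congr_ae (Eventually.of_forall fun t => ?_)
  beta_reduce
  rw [hpT, hpT]
  simp_rw [sub_mul]
  rw [integral_sub (hY1 t.toNNReal).1 (hX1 t.toNNReal).1]
  ring

/-! ### The stub -/

/-- **STUB `stub_limitExchange` of line `gibbs-ttcf` (crux `PhononMeanFreePath.BoundaryKubo`): locally uniform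
Harris → Gibbs TTCF identity → kernel continuity → the linear response of the end kinetic temperature**
`(μ_{T+δ/2,T-δ/2}(p_N²) - T)/δ → (γ/2T²)(∫₀^∞ Y - ∫₀^∞ X)` along any steady family under weak-NESS uniqueness.
Pure measure theory: the family member at `0 < |δ| ≤ δ₀` is the Harris steady state `ν_δ` (uniqueness), at
`δ = 0` the Gibbs state; `S → ∞` in the TTCF identity (`steady_response_of_identity`) gives
`ν_δ(p_N²) - T = δ (γ/2T²) Ψ(δ)`, `Ψ(δ) = ∫₀^∞ μ₀((p_0² - p_N²) K^δ_s p_N²) ds`; `Ψ(δ) → Ψ(0)` by dominated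
convergence in `s` (uniform bound `M e^{-cs}`) and in `z` (`tendsto_corr_delta`, kernel continuity); and
`Ψ(0) = ∫ Y - ∫ X` (`integral_kubo_sub_auto`). [folklore] -/
theorem stub_limitExchange :
    (∀ ω₂ lam β γ : ℝ, 0 < ω₂ → 0 < lam → 0 < β → 0 < γ → ∀ (N : ℕ) (T : ℝ), 0 < T →
      ∃ δ₀ θ C c : ℝ, 0 < δ₀ ∧ δ₀ < 2 * T ∧ 0 < θ ∧ θ * T < 1 ∧ 0 < C ∧ 0 < c ∧
        ∀ δ : ℝ, |δ| ≤ δ₀ →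
          ∃ ν : Measure (PhaseSpace (N + 1)),
            (pinnedChain ω₂ lam β γ).IsSteadyState (N + 1) (T + δ / 2) (T - δ / 2) ν ∧
            Integrable (fun z => Real.exp (θ * (pinnedChain ω₂ lam β γ).hamiltonian (N + 1) z)) ν ∧
            ∀ (z : PhaseSpace (N + 1)) (t : ℝ≥0) (f : PhaseSpace (N + 1) → ℝ), Continuous f →
              (∀ y, |f y| ≤ Real.exp (θ * (pinnedChain ω₂ lam β γ).hamiltonian (N + 1) y)) →
              |(∫ y, f y ∂((pinnedChain ω₂ lam β γ).transitionKernel (N + 1)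
                    (T + δ / 2) (T - δ / 2) t z)) - ∫ y, f y ∂ν| ≤
                C * Real.exp (θ * (pinnedChain ω₂ lam β γ).hamiltonian (N + 1) z) * Real.exp (-c * t)) →
    (∀ ω₂ lam β γ : ℝ, 0 < ω₂ → 0 < lam → 0 < β → 0 < γ → ∀ (N : ℕ) (T : ℝ), 0 < T →
      ∀ δ : ℝ, |δ| < 2 * T → ∀ S : ℝ, 0 ≤ S →
        (∫ z, (∫ y, (y.2 (Fin.last N)) ^ 2
            ∂((pinnedChain ω₂ lam β γ).transitionKernel (N + 1) (T + δ / 2) (T - δ / 2) S.toNNReal z))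
            ∂((pinnedChain ω₂ lam β γ).gibbsMeasure (N + 1) T)) -
          (∫ z, (z.2 (Fin.last N)) ^ 2 ∂((pinnedChain ω₂ lam β γ).gibbsMeasure (N + 1) T)) =
        δ * (γ / (2 * T ^ 2)) *
          ∫ s in (0 : ℝ)..S, ∫ z, ((z.2 0) ^ 2 - (z.2 (Fin.last N)) ^ 2) *
            (∫ y, (y.2 (Fin.last N)) ^ 2
              ∂((pinnedChain ω₂ lam β γ).transitionKernel (N + 1) (T + δ / 2) (T - δ / 2) s.toNNReal z))
            ∂((pinnedChain ω₂ lam β γ).gibbsMeasure (N + 1) T)) →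
    (∀ ω₂ lam β γ : ℝ, 0 < ω₂ → 0 < lam → 0 < β → 0 < γ → ∀ (N : ℕ) (s : ℝ≥0) (z : PhaseSpace (N + 1))
      (f : PhaseSpace (N + 1) → ℝ), Continuous f →
      (∃ (C : ℝ) (k : ℕ), ∀ y, |f y| ≤ C * (1 + (pinnedChain ω₂ lam β γ).hamiltonian (N + 1) y) ^ k) →
      ContinuousOn (fun TT : ℝ × ℝ =>
          ∫ y, f y ∂((pinnedChain ω₂ lam β γ).transitionKernel (N + 1) TT.1 TT.2 s z))
        (Set.Ioi (0 : ℝ) ×ˢ Set.Ioi (0 : ℝ))) →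
    (∀ ω₂ lam β γ : ℝ, 0 < ω₂ → 0 < lam → 0 < β → 0 < γ → UniqueSteady ω₂ lam β γ →
      ∀ μ : (M : ℕ) → ℝ → ℝ → Measure (PhaseSpace M), SteadyFamily ω₂ lam β γ μ →
        ∀ T : ℝ, 0 < T → ∀ N : ℕ,
          Tendsto (fun δ : ℝ =>
              ((∫ z, (z.2 (Fin.last N)) ^ 2 ∂(μ (N + 1) (T + δ / 2) (T - δ / 2))) - T) / δ)
            (𝓝[≠] 0)
            (𝓝 (γ / (2 * T ^ 2) * ((∫ t in Ioi (0 : ℝ), kuboIntegrand ω₂ lam β γ T N t) -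
              ∫ t in Ioi (0 : ℝ), ((∫ z, (z.2 (Fin.last N)) ^ 2 * (∫ y, (y.2 (Fin.last N)) ^ 2
              ∂((pinnedChain ω₂ lam β γ).transitionKernel (N + 1) T T t.toNNReal z))
              ∂((pinnedChain ω₂ lam β γ).gibbsMeasure (N + 1) T)) -
            (∫ z, (z.2 (Fin.last N)) ^ 2 ∂((pinnedChain ω₂ lam β γ).gibbsMeasure (N + 1) T)) *
              (∫ z, (∫ y, (y.2 (Fin.last N)) ^ 2
                ∂((pinnedChain ω₂ lam β γ).transitionKernel (N + 1) T T t.toNNReal z))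
                ∂((pinnedChain ω₂ lam β γ).gibbsMeasure (N + 1) T))))))) := by
  intro hH1 hH2 hH3 ω₂ lam β γ hω hl hβ hγ hU μ hμ T hT N
  -- Harris data, the steady states `ν δ` as a function of `δ`
  obtain ⟨δ₀, θ, C, c, hδ₀, hδ₀T, hθ, hθT, -, hc, hfam⟩ := hH1 ω₂ lam β γ hω hl hβ hγ N T hT
  have hfam' : ∀ δ : ℝ, ∃ ν : Measure (PhaseSpace (N + 1)), |δ| ≤ δ₀ →
      (pinnedChain ω₂ lam β γ).IsSteadyState (N + 1) (T + δ / 2) (T - δ / 2) ν ∧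
      ∀ (z : PhaseSpace (N + 1)) (t : ℝ≥0) (f : PhaseSpace (N + 1) → ℝ), Continuous f →
        (∀ y, |f y| ≤ Real.exp (θ * (pinnedChain ω₂ lam β γ).hamiltonian (N + 1) y)) →
        |(∫ y, f y ∂((pinnedChain ω₂ lam β γ).transitionKernel (N + 1) (T + δ / 2) (T - δ / 2) t z)) -
            ∫ y, f y ∂ν| ≤
          C * Real.exp (θ * (pinnedChain ω₂ lam β γ).hamiltonian (N + 1) z) * Real.exp (-c * t) := by
    intro δ
    by_cases hδ : |δ| ≤ δ₀
    · obtain ⟨ν, hst, -, hH⟩ := hfam δ hδ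
      exact ⟨ν, fun _ => ⟨hst, hH⟩⟩
    · exact ⟨0, fun h => absurd h hδ⟩
  choose ν hν using hfam'
  have hHf := fun δ (hδ : |δ| ≤ δ₀) => (hν δ hδ).2
  -- identification of the steady states (crux uniqueness); at `δ = 0` the Gibbs state
  have hab : ∀ δ : ℝ, |δ| ≤ δ₀ → 0 < T + δ / 2 ∧ 0 < T - δ / 2 := fun δ hδ => by
    have h := abs_le.1 hδ
    constructor <;> linarith
  have hμν : ∀ δ : ℝ, |δ| ≤ δ₀ → μ (N + 1) (T + δ / 2) (T - δ / 2) = ν δ := fun δ hδ =>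
    hU (N + 1) _ _ (hab δ hδ).1 (hab δ hδ).2 _ _ (hμ (N + 1) _ _ (hab δ hδ).1 (hab δ hδ).2) (hν δ hδ).1
  have h0 : |(0 : ℝ)| ≤ δ₀ := by rw [abs_zero]; exact hδ₀.le
  have hν0 : ν 0 = (pinnedChain ω₂ lam β γ).gibbsMeasure (N + 1) T := by
    rw [← hμν 0 h0, zero_div, add_zero, sub_zero]
    exact steadyFamily_apply_self hω hl hβ hU hμ hT (N + 1)
  have hH0 : ∀ (z : PhaseSpace (N + 1)) (t : ℝ≥0) (f : PhaseSpace (N + 1) → ℝ), Continuous f →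
      (∀ y, |f y| ≤ Real.exp (θ * (pinnedChain ω₂ lam β γ).hamiltonian (N + 1) y)) →
      |(∫ y, f y ∂((pinnedChain ω₂ lam β γ).transitionKernel (N + 1) T T t z)) -
          ∫ y, f y ∂((pinnedChain ω₂ lam β γ).gibbsMeasure (N + 1) T)| ≤
        C * Real.exp (θ * (pinnedChain ω₂ lam β γ).hamiltonian (N + 1) z) * Real.exp (-c * t) := by
    have h := hHf 0 h0
    rw [zero_div, add_zero, sub_zero, hν0] at h
    exact h
  -- kernel continuity for `p_N²` along the temperature protocol
  have hK : ∀ (s : ℝ≥0) (z : PhaseSpace (N + 1)), Tendsto (fun δ : ℝ => ∫ y, (y.2 (Fin.last N)) ^ 2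
      ∂((pinnedChain ω₂ lam β γ).transitionKernel (N + 1) (T + δ / 2) (T - δ / 2) s z)) (𝓝 0)
      (𝓝 (∫ y, (y.2 (Fin.last N)) ^ 2 ∂((pinnedChain ω₂ lam β γ).transitionKernel (N + 1) T T s z))) := by
    intro s z
    have hpoly : ∃ (C' : ℝ) (k : ℕ), ∀ y : PhaseSpace (N + 1),
        |y.2 (Fin.last N) ^ 2| ≤ C' * (1 + (pinnedChain ω₂ lam β γ).hamiltonian (N + 1) y) ^ k := by
      refine ⟨2, 1, fun y => ?_⟩
      rw [abs_of_nonneg (sq_nonneg _), pow_one]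
      have h1 := sq_momentum_le_two_mul_hamiltonian hω hl.le hβ.le γ y (Fin.last N)
      linarith
    exact tendsto_temperatures hT (hH3 ω₂ lam β γ hω hl hβ hγ N s z _ (by fun_prop) hpoly)
  -- the integrands `Φ δ`, `Φ₀` and the uniform bound
  set Φ : ℝ → ℝ → ℝ := fun δ s => ∫ z, ((z.2 0) ^ 2 - (z.2 (Fin.last N)) ^ 2) *
      (∫ y, (y.2 (Fin.last N)) ^ 2
        ∂((pinnedChain ω₂ lam β γ).transitionKernel (N + 1) (T + δ / 2) (T - δ / 2) s.toNNReal z))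
      ∂((pinnedChain ω₂ lam β γ).gibbsMeasure (N + 1) T) with hΦ
  set Φ₀ : ℝ → ℝ := fun s => ∫ z, ((z.2 0) ^ 2 - (z.2 (Fin.last N)) ^ 2) *
      (∫ y, (y.2 (Fin.last N)) ^ 2 ∂((pinnedChain ω₂ lam β γ).transitionKernel (N + 1) T T s.toNNReal z))
      ∂((pinnedChain ω₂ lam β γ).gibbsMeasure (N + 1) T) with hΦ₀
  set ϑ := (1 / T - θ) / 2 with hϑ
  set MΦ := 2 / θ * C * (4 / ϑ) *
      (∫ z, Real.exp ((θ + ϑ) * (pinnedChain ω₂ lam β γ).hamiltonian (N + 1) z)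
        ∂((pinnedChain ω₂ lam β γ).gibbsMeasure (N + 1) T)) with hMΦ
  have hθT' : θ < 1 / T := by rwa [lt_div_iff₀ hT]
  have hϑ0 : 0 < ϑ := by rw [hϑ]; linarith
  have hθϑ : θ + ϑ < 1 / T := by rw [hϑ]; linarith
  haveI : IsProbabilityMeasure ((pinnedChain ω₂ lam β γ).gibbsMeasure (N + 1) T) :=
    pinnedChain_isProbabilityMeasure_gibbsMeasure hω hl.le hβ.le γ (N + 1) hT
  -- Step C: `S → ∞` in the TTCF identity, for every `|δ| ≤ δ₀`
  have hC := fun δ (hδ : |δ| ≤ δ₀) => steady_response_of_identity hω hl.le hβ.le hγ.le hθ hc (hHf δ hδ) hT hθT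
    (hH2 ω₂ lam β γ hω hl hβ hγ N T hT δ (lt_of_le_of_lt hδ hδ₀T))
  -- Step D: `δ → 0` inside the time integral
  have hev : ∀ᶠ δ in 𝓝 (0 : ℝ), |δ| ≤ δ₀ := by
    filter_upwards [eventually_abs_sub_lt 0 hδ₀] with δ hδ
    rw [sub_zero] at hδ
    exact hδ.le
  have hΨ : Tendsto (fun δ => ∫ s in Ioi (0 : ℝ), Φ δ s) (𝓝 0) (𝓝 (∫ s in Ioi (0 : ℝ), Φ₀ s)) := by
    refine tendsto_integral_filter_of_dominated_convergence (fun s => MΦ * Real.exp (-c * s)) ?_ ?_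
      ((exp_neg_integrableOn_Ioi 0 hc).const_mul MΦ) ?_
    · exact Eventually.of_forall fun δ => (measurable_corr_time hω hl.le hβ.le hγ.le (N + 1) _ _ _
        (by fun_prop) (by fun_prop)).aestronglyMeasurable
    · filter_upwards [hev] with δ hδ
      exact (ae_restrict_iff' measurableSet_Ioi).2 (Eventually.of_forall fun s hs => by
        rw [Real.norm_eq_abs]; exact (hC δ hδ).2.1 s (le_of_lt hs))
    · refine (ae_restrict_iff' measurableSet_Ioi).2 (Eventually.of_forall fun s _ => ?_)
      exact tendsto_corr_delta hω hl.le hβ.le hγ.le hT hδ₀ hθ hHf hK hθϑ (by fun_prop)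
        (fun z => abs_sq_sub_sq_le_exp (pinnedChain_isConfining hω hl.le hβ.le hγ.le) hϑ0 (N + 1) z 0
          (Fin.last N)) s.toNNReal
  -- Step E: the value at `δ = 0`, and assembly
  have hval := integral_kubo_sub_auto hω hl.le hβ.le hγ.le hT hθ hθT hc hH0
  have hlim : Tendsto (fun δ : ℝ => γ / (2 * T ^ 2) * ∫ s in Ioi (0 : ℝ), Φ δ s) (𝓝[≠] 0)
      (𝓝 (γ / (2 * T ^ 2) * ((∫ t in Ioi (0 : ℝ), kuboIntegrand ω₂ lam β γ T N t) -
              ∫ t in Ioi (0 : ℝ), ((∫ z, (z.2 (Fin.last N)) ^ 2 * (∫ y, (y.2 (Fin.last N)) ^ 2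
              ∂((pinnedChain ω₂ lam β γ).transitionKernel (N + 1) T T t.toNNReal z))
              ∂((pinnedChain ω₂ lam β γ).gibbsMeasure (N + 1) T)) -
            (∫ z, (z.2 (Fin.last N)) ^ 2 ∂((pinnedChain ω₂ lam β γ).gibbsMeasure (N + 1) T)) *
              (∫ z, (∫ y, (y.2 (Fin.last N)) ^ 2
                ∂((pinnedChain ω₂ lam β γ).transitionKernel (N + 1) T T t.toNNReal z))
                ∂((pinnedChain ω₂ lam β γ).gibbsMeasure (N + 1) T)))))) := by
    rw [hval]
    exact (hΨ.const_mul _).mono_left nhdsWithin_le_nhds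
  refine hlim.congr' ?_
  have hev' : ∀ᶠ δ in 𝓝[≠] (0 : ℝ), |δ| ≤ δ₀ ∧ δ ≠ 0 :=
    (eventually_nhdsWithin_of_eventually_nhds hev).and self_mem_nhdsWithin
  filter_upwards [hev'] with δ ⟨hδ, hne⟩
  rw [hμν δ hδ, (hC δ hδ).2.2, mul_assoc, mul_div_cancel_left₀ _ hne]

end Summit.AtomisticToContinuum.FouriersLaw.Theorems.BoundaryKubo.GibbsTtcf

end
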